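import Mathlib.Analysis.ODE.ExistUnique
import Literature.MathematicalPhysics.KineticTheory.InfiniteChainDynamics
import Literature.MathematicalPhysics.KineticTheory.LangevinChainSDE
import HarnessLib

/-!
# Condition B1 of Lanford–Lebowitz–Lieb (1977) is a hypothesis: a chain whose severed dynamics blows up

Topic `Literature/MathematicalPhysics/KineticTheory`; companion of `InfiniteChainDynamics.lean`
(the named predicate `OscillatorChain.CondB1`) and of `InfiniteChainDynamicsCondB1.lean` (the
positive result `OscillatorChain.condB1_of_bddBelow`).

`OscillatorChain.CondB1 P` is Lanford–Lebowitz–Lieb's condition **B1** (J. Stat. Phys. **16**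
(1977) 453–461, §4, p. 459): "for each finite subset `Λ` of `ℤ^ν`, the [severed] equations of
motion (9a)–(9c) admit solutions for all time for all initial points". In the source this is an
ASSUMPTION (of their Theorems 3 and 4), not a result, and it genuinely depends on the chain data
`P = (U, V, γ)`: this file records, kernel-checked, that it FAILS for the chain
`freeQuarticChain` with the concave quartic pinning `U(q) = -q⁴/2` and no interaction `V = 0`.
For `Λ = {0}` the severed system is `q̇ = p`, `ṗ = -U'(q) = 2q³`, whose solution with
`(q, p)(0) = (1, 1)` is `q(t) = 1/(1 - t)`, `p(t) = 1/(1 - t)²` (explicit), unique while it exists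
(Picard–Lindelöf, Mathlib `ODE_solution_unique_of_mem_Icc_right`, the field being `C¹` hence
Lipschitz on balls), and unbounded as `t → 1⁻`; a global severed solution would be continuous on
`[0, 1]`, hence bounded there — contradiction. Consequently `∀ P, P.CondB1` is false
(`not_forall_condB1`): the predicate can only be DISCHARGED under hypotheses on `U, V`
(`condB1_of_bddBelow`: `U, V ∈ C²` bounded below).

## Contents (all proved, [folklore])

* `freeQuarticChain` — the chain `U(q) = -q⁴/2`, `V = 0`, `γ = 0`.
* `OscillatorChain.not_condB1_freeQuarticChain : ¬ freeQuarticChain.CondB1`.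
* `OscillatorChain.not_forall_condB1 : ¬ ∀ P : OscillatorChain, P.CondB1`.

## References

* O. E. Lanford III, J. L. Lebowitz, E. H. Lieb, *Time evolution of infinite anharmonic systems*,
  J. Stat. Phys. 16 (1977) 453–461, §2 eqs. (9a)–(9c), §4 condition B1. [LanfordLebowitzLieb1977]
-/

noncomputable section

open Set Metric Filter Topology

open scoped NNReal

namespace Literature.MathematicalPhysics.KineticTheory.HeatConduction

/-- The oscillator chain with the concave quartic pinning `U(q) = -q⁴/2`, no interaction (`V = 0`)
and bath constant `γ = 0` — a chain for which LLL's condition B1 fails (its severed one-particle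
dynamics `q̈ = 2q³` blows up in finite time). An ordinary counterexample, not a physical model.
[folklore] -/
def freeQuarticChain : OscillatorChain where
  U q := -(q ^ 4 / 2)
  V _ := 0
  γ := 0

namespace OscillatorChain

/-- **Condition B1 fails for `freeQuarticChain`.** For `Λ = {0}` and the initial point
`(q₀, p₀) = (1, 1)` the severed equations (9a)–(9c), here `q̇ = p`, `ṗ = 2q³`, have the explicit
solution `q(t) = 1/(1-t)`, `p(t) = 1/(1-t)²` on `[0, 1)`; by uniqueness (the field
`(q, p) ↦ (p, 2q³)` is `C¹`, hence Lipschitz on every ball) any severed solution from this point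
agrees with it on `[0, τ]` for every `τ < 1`, so it is unbounded on `[0, 1)`, contradicting the
continuity on `[0, 1]` of a solution defined for all times. [folklore] -/
theorem not_condB1_freeQuarticChain : ¬ freeQuarticChain.CondB1 := by
  intro h
  obtain ⟨γ, hγ0, hsol, -⟩ := h {0} (fun _ => (1, 1))
  have hdU : ∀ x : ℝ, deriv freeQuarticChain.U x = -(2 * x ^ 3) := fun x => by
    have hd : HasDerivAt (fun q : ℝ => -(q ^ 4 / 2)) (-(↑(4 : ℕ) * x ^ (4 - 1) / 2)) x :=
      ((hasDerivAt_pow 4 x).div_const 2).neg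
    show deriv (fun q : ℝ => -(q ^ 4 / 2)) x = _
    rw [hd.deriv]
    norm_num
    ring
  have hdV : ∀ x : ℝ, deriv freeQuarticChain.V x = 0 := fun x => by
    show deriv (fun _ : ℝ => (0 : ℝ)) x = 0
    exact deriv_const x 0
  have hforce : ∀ σ' : ChainConfig, freeQuarticChain.force σ' 0 = 2 * (σ' 0).1 ^ 3 := fun σ' => by
    rw [force_eq, hdU, hdV, hdV]
    ring
  -- the moving particle as a curve in `ℝ × ℝ`, solving `u' = (u.2, 2 u.1³)`
  set u : ℝ → ℝ × ℝ := fun t => γ t 0 with hu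
  have hu' : ∀ t, HasDerivAt u ((u t).2, 2 * (u t).1 ^ 3) t := fun t => by
    obtain ⟨h1, h2⟩ := hsol 0 (Finset.mem_singleton_self 0) t
    rw [hforce] at h2
    simpa [hu] using h1.prodMk h2
  have hu0 : u 0 = (1, 1) := by simp [hu, hγ0]
  -- the explicit solution `(1/(1-t), 1/(1-t)²)`, which blows up at `t = 1`
  set e : ℝ → ℝ × ℝ := fun t => ((1 - t)⁻¹, (1 - t)⁻¹ ^ 2) with he
  have he' : ∀ t < 1, HasDerivAt e ((e t).2, 2 * (e t).1 ^ 3) t := fun t ht => by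
    have hne : (1 : ℝ) - t ≠ 0 := (sub_pos.2 ht).ne'
    have hw : HasDerivAt (fun y : ℝ => (1 - y)⁻¹) ((1 - t)⁻¹ ^ 2) t := by
      refine (((hasDerivAt_id' t).const_sub 1).inv hne).congr_deriv ?_
      rw [neg_neg, one_div, inv_pow]
    refine (hw.prodMk (hw.fun_pow 2)).congr_deriv ?_
    simp only [he, Nat.cast_ofNat, Nat.add_one_sub_one, pow_one]
    rw [Prod.mk.injEq]
    exact ⟨rfl, by ring⟩
  -- a bound for `u` on `[0, 1]` (it is continuous there)
  obtain ⟨B, hB⟩ := (isCompact_Icc (a := (0 : ℝ)) (b := 1)).exists_bound_of_continuousOn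
    (HasDerivAt.continuousOn fun t _ => hu' t)
  have hB0 : 0 ≤ B := (norm_nonneg _).trans (hB 0 ⟨le_rfl, zero_le_one⟩)
  -- uniqueness: `u = e` on `[0, τ]` for every `τ < 1`
  have hvC : ContDiff ℝ 1 (fun x : ℝ × ℝ => (x.2, 2 * x.1 ^ 3)) := by fun_prop
  have huniq : ∀ τ, 0 < τ → τ < 1 → u τ = e τ := by
    intro τ hτ0 hτ1
    set ρ : ℝ := max B ((1 - τ)⁻¹ ^ 2) with hρ
    obtain ⟨K, hK⟩ := exists_lipschitzOnWith_closedBall hvC ρ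
    have hmem_e : ∀ t ∈ Ico 0 τ, e t ∈ closedBall (0 : ℝ × ℝ) ρ := by
      intro t ht
      have h1t : 0 < 1 - t := by linarith [ht.2]
      have hw0 : 0 < (1 - t)⁻¹ := inv_pos.2 h1t
      have hw1 : 1 ≤ (1 - t)⁻¹ := (one_le_inv₀ h1t).2 (by linarith [ht.1])
      have hwle : (1 - t)⁻¹ ≤ (1 - τ)⁻¹ := inv_anti₀ (by linarith) (by linarith [ht.2])
      rw [mem_closedBall_zero_iff, Prod.norm_def, max_le_iff, Real.norm_eq_abs, Real.norm_eq_abs,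
        abs_of_pos hw0, abs_of_nonneg (by positivity)]
      constructor
      · calc (1 - t)⁻¹ ≤ (1 - t)⁻¹ ^ 2 := by nlinarith
          _ ≤ (1 - τ)⁻¹ ^ 2 := by gcongr
          _ ≤ ρ := le_max_right _ _
      · calc (1 - t)⁻¹ ^ 2 ≤ (1 - τ)⁻¹ ^ 2 := by gcongr
          _ ≤ ρ := le_max_right _ _
    have hmem_u : ∀ t ∈ Ico 0 τ, u t ∈ closedBall (0 : ℝ × ℝ) ρ := fun t ht =>
      mem_closedBall_zero_iff.2 ((hB t ⟨ht.1, ht.2.le.trans hτ1.le⟩).trans (le_max_left _ _))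
    have := ODE_solution_unique_of_mem_Icc_right (v := fun _ x => (x.2, 2 * x.1 ^ 3))
      (s := fun _ => closedBall 0 ρ) (K := K) (fun _ _ => hK)
      (HasDerivAt.continuousOn fun t _ => hu' t)
      (fun t _ => (hu' t).hasDerivWithinAt) hmem_u
      (HasDerivAt.continuousOn fun t ht => he' t (lt_of_le_of_lt ht.2 hτ1))
      (fun t ht => (he' t (ht.2.trans hτ1)).hasDerivWithinAt) hmem_e
      (by rw [hu0]; simp [he])
    exact this ⟨hτ0.le, le_rfl⟩
  -- contradiction at `τ = 1 - 1/(B + 2)`, where `e` exceeds the bound `B`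
  set τ : ℝ := 1 - (B + 2)⁻¹ with hτ
  have hτ0 : 0 < τ := by
    have : (B + 2 : ℝ)⁻¹ < 1 := inv_lt_one_of_one_lt₀ (by linarith)
    rw [hτ]; linarith
  have hτ1 : τ < 1 := by
    have : 0 < (B + 2 : ℝ)⁻¹ := by positivity
    rw [hτ]; linarith
  have h1 := hB τ ⟨hτ0.le, hτ1.le⟩
  rw [huniq τ hτ0 hτ1] at h1
  have h2 : (B + 2 : ℝ) ≤ ‖e τ‖ := by
    have h3 : (e τ).1 = B + 2 := by simp [he, hτ]
    calc (B + 2 : ℝ) = ‖(e τ).1‖ := by rw [h3, Real.norm_eq_abs, abs_of_pos (by positivity)]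
      _ ≤ ‖e τ‖ := norm_fst_le _
  linarith

/-- **`CondB1` is not a theorem about all chains**: its universal closure over the chain data is
false (witness `freeQuarticChain`). LLL 1977 accordingly ASSUME B1 (§4, p. 459); the tree
discharges it only under hypotheses (`condB1_of_bddBelow`). [folklore] -/
theorem not_forall_condB1 : ¬ ∀ P : OscillatorChain, P.CondB1 := fun h =>
  not_condB1_freeQuarticChain (h _)

end OscillatorChain

end Literature.MathematicalPhysics.KineticTheory.HeatConduction

end
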